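import Summits.ABC.ABC.Theses.DefiniteXi
import Summits.ABC.ABC.Theorems.DefiniteXiFreyModularity
import Literature.NumberTheory.Automorphic.ShimuraCurveTakahashiCoordinateInputs
import Literature.NumberTheory.Automorphic.ShimuraCurveRibetTakahashiBrandtDictionaryProofs
import Literature.NumberTheory.EllipticCurves.PastenHeightBoundsLemma68LocalProofs
import Literature.NumberTheory.EllipticCurves.ManinConstantArbitraryParametrizationIntegralProofs
import Literature.NumberTheory.EllipticCurves.TakahashiDegreeFormulaCoprimeProofs
import HarnessLib

/-!
# Stub-ideation sketch (k = 1, gen 2, HOME family 1 — RECOGNISE & IMPORT) for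
# `P6TamagawaSplit.stub_xiDegreeComparison` (crux `SteinbergCore`, stmt-ABC-15024)

Elaboration check of the helper lemmas named in `STUB-IDEAS-stub_xiDegreeComparison-1.md`:
the stub's registered signature is, verbatim, the conclusion of the tree theorem
`Summit.ABC.ABC.Theorems.XiDegreeComparisonItems.stub_xiDegreeComparison_of_items` (p162272); its five
hypotheses are fed BY NAME from Literature named facts (`takahashi2001_thm_2_3_shimura_level`,
`takahashi2001_thm_2_3_shimura_disc`, `mazurKenku_exists_cyclic_isogeny`,
`nonempty_shimuraParametrizationData`, `nonempty_modularParametrizationData`). No `sorry` below except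
where marked (none intended).
-/

namespace Summit.ABC.ABC.Cruxes.SteinbergCore.P6TamagawaSplit.StubIdeas1G2Lite

open Literature.NumberTheory.EllipticCurves Literature.NumberTheory.EllipticCurves.ModularForms
open Literature.NumberTheory.Automorphic

/-- H-A1: the route item `IsogenyValuationTransport` (= Pasten 2024 Lemma 6.8, `Iff.rfl`) from Mazur–Kenku. -/
theorem isogenyValuationTransport_of_mazurKenku (hMK : mazurKenku_exists_cyclic_isogeny) :
    Summit.ABC.ABC.Theses.DefiniteXi.IsogenyValuationTransport :=
  -- `IsogenyValuationTransport` is `PastenShimura2024_lemma_6_8` verbatim (tree: `isogenyValuationTransport_iff := Iff.rfl`,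
  -- `DefiniteXiXiStrongBoundItemsCalibration`); fed by definitional unfolding to keep the import cone small.
  PastenShimura2024_lemma_6_8_of_mazurKenku' hMK

/-- H-A1′: the route item `MazurKenkuBound` (= Pasten's `deg ≤ 163·δ₀`, `Iff.rfl`) from Mazur–Kenku. -/
theorem mazurKenkuBound_of_mazurKenku (hMK : mazurKenku_exists_cyclic_isogeny) :
    Summit.ABC.ABC.Theses.DefiniteXi.MazurKenkuBound :=
  -- `MazurKenkuBound` is `PastenShimura2024_minimalDegree_le_163_mul` verbatim (tree: `mazurKenkuBound_iff := Iff.rfl`).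
  PastenShimura2024_minimalDegree_le_163_mul_of_mazurKenku' hMK

/-- H-A2: **the stub, verbatim, from five named Literature facts** (Takahashi 2001 Thm. 2.3 for `X₀^D(M)` on the
level side and on the discriminant side, Mazur–Kenku, Jacquet–Langlands parametrisations, modularity). -/
theorem stub_xiDegreeComparison_of_namedFacts
    /- `items` := the declared type, verbatim, of `XiDegreeComparisonItems.stub_xiDegreeComparison_of_items` (p162272) -/
    (items : (∀ {N D M p m : ℕ}, p.Prime → M = p * m → ¬ p ∣ m →
      Literature.NumberTheory.Automorphic.IsAdmissibleFactorization N D M →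
      ∀ (X : Literature.NumberTheory.Automorphic.ShimuraCurveData D M) (W : WeierstrassCurve ℚ)
        [W.IsElliptic], W.conductorNorm ℤ = N →
      ∀ (W' : WeierstrassCurve ℚ) [W'.IsElliptic]
        (P : Literature.NumberTheory.Automorphic.ShimuraParametrizationData X W'), P.IsMinimalFor W →
      ∀ S : Literature.NumberTheory.Automorphic.Brandt.XiSetup m (D * p),
        ∃ i j : ℕ, 0 < i ∧ i * j = (W'.minimalDiscriminantNorm ℤ).factorization p ∧
          i ∣ S.xi (fun n => W'.LFunction n) ∧ P.deg * i = S.xi (fun n => W'.LFunction n) * j) →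
    (∀ {N D M p d : ℕ}, p.Prime → D = p * d →
      Literature.NumberTheory.Automorphic.IsAdmissibleFactorization N D M →
      ∀ (X : Literature.NumberTheory.Automorphic.ShimuraCurveData D M) (W : WeierstrassCurve ℚ)
        [W.IsElliptic], W.conductorNorm ℤ = N →
      ∀ (W' : WeierstrassCurve ℚ) [W'.IsElliptic]
        (P : Literature.NumberTheory.Automorphic.ShimuraParametrizationData X W'), P.IsMinimalFor W →
      ∀ S : Literature.NumberTheory.Automorphic.Brandt.XiSetup (p * M) d,
        ∃ i j : ℕ, 0 < i ∧ i * j = (W'.minimalDiscriminantNorm ℤ).factorization p ∧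
          i ∣ S.xi (fun n => W'.LFunction n) ∧ P.deg * i = S.xi (fun n => W'.LFunction n) * j) →
    Summit.ABC.ABC.Theses.DefiniteXi.IsogenyValuationTransport →
    Literature.NumberTheory.Automorphic.nonempty_shimuraParametrizationData →
    Summit.ABC.ABC.Theses.DefiniteXi.FreyModularity →
    ∀ ε : ℝ, 0 < ε → ∃ C : ℝ, ∀ a b : ℤ, IsCoprime a b → a * b * (a + b) ≠ 0 → ∀ (N : ℕ) [NeZero N],
      (Literature.NumberTheory.EllipticCurves.freyCurve a b).conductorNorm ℤ = N →
      ∀ Nm : ℕ, Odd Nm → Squarefree Nm → Odd Nm.primeFactors.card → Nm ∣ N →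
      Literature.NumberTheory.Automorphic.brandtXi (N / Nm) Nm
          (fun n => (Literature.NumberTheory.EllipticCurves.freyCurve a b).LFunction n) ≠ 0 →
      ∃ D : Literature.NumberTheory.EllipticCurves.ModularForms.ModularParametrizationData
        (Literature.NumberTheory.EllipticCurves.freyCurve a b) N,
        (∀ D' : Literature.NumberTheory.EllipticCurves.ModularForms.ModularParametrizationData
          (Literature.NumberTheory.EllipticCurves.freyCurve a b) N, D.deg ≤ D'.deg) ∧
        ((Literature.NumberTheory.Automorphic.brandtXi (N / Nm) Nm
              (fun n => (Literature.NumberTheory.EllipticCurves.freyCurve a b).LFunction n) /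
            (ordProj[2] (Literature.NumberTheory.Automorphic.brandtXi (N / Nm) Nm
                (fun n => (Literature.NumberTheory.EllipticCurves.freyCurve a b).LFunction n)) *
              ordProj[3] (Literature.NumberTheory.Automorphic.brandtXi (N / Nm) Nm
                (fun n => (Literature.NumberTheory.EllipticCurves.freyCurve a b).LFunction n))) : ℕ) : ℝ) ≤
          C * (N : ℝ) ^ ε * ((D.deg / (ordProj[2] D.deg * ordProj[3] D.deg) : ℕ) : ℝ) *
            ((∏ q ∈ N.primeFactors, ((Literature.NumberTheory.EllipticCurves.freyCurve a b).minimalDiscriminantNorm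
              ℤ).factorization q : ℕ) : ℝ) ^ 3)
    (hL : takahashi2001_thm_2_3_shimura_level) (hD : takahashi2001_thm_2_3_shimura_disc)
    (hMK : mazurKenku_exists_cyclic_isogeny) (hJL : nonempty_shimuraParametrizationData)
    (hmod : nonempty_modularParametrizationData) :
    ∀ ε : ℝ, 0 < ε → ∃ C : ℝ, ∀ a b : ℤ, IsCoprime a b → a * b * (a + b) ≠ 0 → ∀ (N : ℕ) [NeZero N],
      (Literature.NumberTheory.EllipticCurves.freyCurve a b).conductorNorm ℤ = N →
      ∀ Nm : ℕ, Odd Nm → Squarefree Nm → Odd Nm.primeFactors.card → Nm ∣ N →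
      Literature.NumberTheory.Automorphic.brandtXi (N / Nm) Nm
          (fun n => (Literature.NumberTheory.EllipticCurves.freyCurve a b).LFunction n) ≠ 0 →
      ∃ D : Literature.NumberTheory.EllipticCurves.ModularForms.ModularParametrizationData
        (Literature.NumberTheory.EllipticCurves.freyCurve a b) N,
        (∀ D' : Literature.NumberTheory.EllipticCurves.ModularForms.ModularParametrizationData
          (Literature.NumberTheory.EllipticCurves.freyCurve a b) N, D.deg ≤ D'.deg) ∧
        ((Literature.NumberTheory.Automorphic.brandtXi (N / Nm) Nm
              (fun n => (Literature.NumberTheory.EllipticCurves.freyCurve a b).LFunction n) /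
            (ordProj[2] (Literature.NumberTheory.Automorphic.brandtXi (N / Nm) Nm
                (fun n => (Literature.NumberTheory.EllipticCurves.freyCurve a b).LFunction n)) *
              ordProj[3] (Literature.NumberTheory.Automorphic.brandtXi (N / Nm) Nm
                (fun n => (Literature.NumberTheory.EllipticCurves.freyCurve a b).LFunction n))) : ℕ) : ℝ) ≤
          C * (N : ℝ) ^ ε * ((D.deg / (ordProj[2] D.deg * ordProj[3] D.deg) : ℕ) : ℝ) *
            ((∏ q ∈ N.primeFactors, ((Literature.NumberTheory.EllipticCurves.freyCurve a b).minimalDiscriminantNorm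
              ℤ).factorization q : ℕ) : ℝ) ^ 3 :=
  items hL hD (isogenyValuationTransport_of_mazurKenku hMK) hJL
    (Summit.ABC.ABC.Theorems.freyModularity_of_nonempty_modularParametrizationData hmod)

/-- H-A2′: the same with modularity kept as the ROUTE's own item `FreyModularity` (stmt-ABC-11340) — the form to land
`--supports stmt-ABC-15024`, so that the block on this stub does not re-count modularity. -/
theorem stub_xiDegreeComparison_of_namedFacts'
    (items : (∀ {N D M p m : ℕ}, p.Prime → M = p * m → ¬ p ∣ m →
      Literature.NumberTheory.Automorphic.IsAdmissibleFactorization N D M →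
      ∀ (X : Literature.NumberTheory.Automorphic.ShimuraCurveData D M) (W : WeierstrassCurve ℚ)
        [W.IsElliptic], W.conductorNorm ℤ = N →
      ∀ (W' : WeierstrassCurve ℚ) [W'.IsElliptic]
        (P : Literature.NumberTheory.Automorphic.ShimuraParametrizationData X W'), P.IsMinimalFor W →
      ∀ S : Literature.NumberTheory.Automorphic.Brandt.XiSetup m (D * p),
        ∃ i j : ℕ, 0 < i ∧ i * j = (W'.minimalDiscriminantNorm ℤ).factorization p ∧
          i ∣ S.xi (fun n => W'.LFunction n) ∧ P.deg * i = S.xi (fun n => W'.LFunction n) * j) →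
    (∀ {N D M p d : ℕ}, p.Prime → D = p * d →
      Literature.NumberTheory.Automorphic.IsAdmissibleFactorization N D M →
      ∀ (X : Literature.NumberTheory.Automorphic.ShimuraCurveData D M) (W : WeierstrassCurve ℚ)
        [W.IsElliptic], W.conductorNorm ℤ = N →
      ∀ (W' : WeierstrassCurve ℚ) [W'.IsElliptic]
        (P : Literature.NumberTheory.Automorphic.ShimuraParametrizationData X W'), P.IsMinimalFor W →
      ∀ S : Literature.NumberTheory.Automorphic.Brandt.XiSetup (p * M) d,
        ∃ i j : ℕ, 0 < i ∧ i * j = (W'.minimalDiscriminantNorm ℤ).factorization p ∧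
          i ∣ S.xi (fun n => W'.LFunction n) ∧ P.deg * i = S.xi (fun n => W'.LFunction n) * j) →
    Summit.ABC.ABC.Theses.DefiniteXi.IsogenyValuationTransport →
    Literature.NumberTheory.Automorphic.nonempty_shimuraParametrizationData →
    Summit.ABC.ABC.Theses.DefiniteXi.FreyModularity →
    ∀ ε : ℝ, 0 < ε → ∃ C : ℝ, ∀ a b : ℤ, IsCoprime a b → a * b * (a + b) ≠ 0 → ∀ (N : ℕ) [NeZero N],
      (Literature.NumberTheory.EllipticCurves.freyCurve a b).conductorNorm ℤ = N →
      ∀ Nm : ℕ, Odd Nm → Squarefree Nm → Odd Nm.primeFactors.card → Nm ∣ N →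
      Literature.NumberTheory.Automorphic.brandtXi (N / Nm) Nm
          (fun n => (Literature.NumberTheory.EllipticCurves.freyCurve a b).LFunction n) ≠ 0 →
      ∃ D : Literature.NumberTheory.EllipticCurves.ModularForms.ModularParametrizationData
        (Literature.NumberTheory.EllipticCurves.freyCurve a b) N,
        (∀ D' : Literature.NumberTheory.EllipticCurves.ModularForms.ModularParametrizationData
          (Literature.NumberTheory.EllipticCurves.freyCurve a b) N, D.deg ≤ D'.deg) ∧
        ((Literature.NumberTheory.Automorphic.brandtXi (N / Nm) Nm
              (fun n => (Literature.NumberTheory.EllipticCurves.freyCurve a b).LFunction n) /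
            (ordProj[2] (Literature.NumberTheory.Automorphic.brandtXi (N / Nm) Nm
                (fun n => (Literature.NumberTheory.EllipticCurves.freyCurve a b).LFunction n)) *
              ordProj[3] (Literature.NumberTheory.Automorphic.brandtXi (N / Nm) Nm
                (fun n => (Literature.NumberTheory.EllipticCurves.freyCurve a b).LFunction n))) : ℕ) : ℝ) ≤
          C * (N : ℝ) ^ ε * ((D.deg / (ordProj[2] D.deg * ordProj[3] D.deg) : ℕ) : ℝ) *
            ((∏ q ∈ N.primeFactors, ((Literature.NumberTheory.EllipticCurves.freyCurve a b).minimalDiscriminantNorm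
              ℤ).factorization q : ℕ) : ℝ) ^ 3)
    (hL : takahashi2001_thm_2_3_shimura_level) (hD : takahashi2001_thm_2_3_shimura_disc)
    (hMK : mazurKenku_exists_cyclic_isogeny) (hJL : nonempty_shimuraParametrizationData)
    (hMod : Summit.ABC.ABC.Theses.DefiniteXi.FreyModularity) :
    ∀ ε : ℝ, 0 < ε → ∃ C : ℝ, ∀ a b : ℤ, IsCoprime a b → a * b * (a + b) ≠ 0 → ∀ (N : ℕ) [NeZero N],
      (Literature.NumberTheory.EllipticCurves.freyCurve a b).conductorNorm ℤ = N →
      ∀ Nm : ℕ, Odd Nm → Squarefree Nm → Odd Nm.primeFactors.card → Nm ∣ N →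
      Literature.NumberTheory.Automorphic.brandtXi (N / Nm) Nm
          (fun n => (Literature.NumberTheory.EllipticCurves.freyCurve a b).LFunction n) ≠ 0 →
      ∃ D : Literature.NumberTheory.EllipticCurves.ModularForms.ModularParametrizationData
        (Literature.NumberTheory.EllipticCurves.freyCurve a b) N,
        (∀ D' : Literature.NumberTheory.EllipticCurves.ModularForms.ModularParametrizationData
          (Literature.NumberTheory.EllipticCurves.freyCurve a b) N, D.deg ≤ D'.deg) ∧
        ((Literature.NumberTheory.Automorphic.brandtXi (N / Nm) Nm
              (fun n => (Literature.NumberTheory.EllipticCurves.freyCurve a b).LFunction n) /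
            (ordProj[2] (Literature.NumberTheory.Automorphic.brandtXi (N / Nm) Nm
                (fun n => (Literature.NumberTheory.EllipticCurves.freyCurve a b).LFunction n)) *
              ordProj[3] (Literature.NumberTheory.Automorphic.brandtXi (N / Nm) Nm
                (fun n => (Literature.NumberTheory.EllipticCurves.freyCurve a b).LFunction n))) : ℕ) : ℝ) ≤
          C * (N : ℝ) ^ ε * ((D.deg / (ordProj[2] D.deg * ordProj[3] D.deg) : ℕ) : ℝ) *
            ((∏ q ∈ N.primeFactors, ((Literature.NumberTheory.EllipticCurves.freyCurve a b).minimalDiscriminantNorm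
              ℤ).factorization q : ℕ) : ℝ) ^ 3 :=
  items hL hD (isogenyValuationTransport_of_mazurKenku hMK) hJL hMod

/-! H-C1 (Plan C, re-sourcing only): the tree ALREADY proves `takahashi2001_thm_2_3_shimura_disc` /
`_level` pointwise from the character-group dictionaries — section theorems
`Literature.NumberTheory.Automorphic.thm_2_3_disc_of_brandtDictionary` (hypothesis `hDictDisc`, with the
rank-one conjunct) and `…thm_2_3_level_of_brandtDictionary` (hypothesis `hDict`). We only certify the names. -/
#check @Literature.NumberTheory.Automorphic.thm_2_3_disc_of_brandtDictionary
#check @Literature.NumberTheory.Automorphic.thm_2_3_level_of_brandtDictionary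
#check @Literature.NumberTheory.EllipticCurves.takahashi2001_thm_2_3_of_coprime_of_brandtDictionary_one'

end Summit.ABC.ABC.Cruxes.SteinbergCore.P6TamagawaSplit.StubIdeas1G2Lite
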